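import Summits.FinalStateConjecture.FinalStateConjecture.Theorems.PhaseMixingCaptureCaptureSufficesTameNoC0GlueGen
import HarnessLib

/-!
# `CaptureSufficesTame` (stmt-FinalStateConjecture-17270), line `only-the-third-law-is-generic`: the glue stub
# `stub_noC0_glue`, ORIENTED form `stub_noC0_glue_oriented`

The lead's limit theorem NoC0KerrChart (no late `C⁰`-honest chart of a Kerr exterior into Minkowski space) consumes,
for each level, the interface properties of the flat causal future `J` of `P = Φ p₀` inside the chart image
`U = Φ '' Ω'`, pulled back to the Kerr chunk `Ω'` by the chart `Φ`: `C = Ω' ∩ Φ⁻¹(closure J)`,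
`O = Ω' ∩ Φ⁻¹(interior J)`; `O ⊆ C ⊆ Ω'`, `O` open, `C` relatively closed; (H-D) push-up; (H-p) `p₀ ∈ C ∖ O`;
(H-t) `t* ≥ p₀⁰` on `C`; (H-reach) reachability by `t*`-parametrised `Φ^*η`-causal paths; (H-gen) generators through
boundary points near `p₀`. This file assembles them (`stub_noC0_glue_oriented`) from the helper files
`…NoC0GlueChart` (chart toolkit), `…NoC0GlueCurves` (curve transport, `t*`-reparametrisation), `…NoC0GlueSets`
(basics, H-D, H-p, H-t, H-reach) and `…NoC0GlueGen` (H-gen), the flat bricks F1/F2 and the kinematic brick K3.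

ORIENTATION. The registered text of `stub_noC0_glue` has no time-orientation hypothesis on `Φ` and is false as stated:
for the time reflection `Φ(x⁰, x⃗) = (−x⁰, x⃗)` (an exact isometry of `η`, and `‖η − g_{M,a}‖ ≤ ε` far out in the
exterior or for `M = 0`) the set `C` is the pulled-back causal PAST of `p₀`, violating (H-t). The statement proved
here adds exactly one hypothesis, inserted after the metric bound: `DΦ_y` maps future `Φ^*η`-causal vectors
(`(Φ^*η)(v, v) ≤ 0 < v⁰`) to vectors with positive time component, for `y ∈ Ω` (dischargeable on a preconnected `Ω`
by `…NoC0GlueOrient`: orientation dichotomy + time reflection); and, at the lead's request, (H-gen) carries the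
EXPLICIT radius `d₁ = infDist p₀ Ω'ᶜ / 4` instead of `∃ d₁ > 0`.

References: B. O'Neill, *Semi-Riemannian geometry*, Academic Press 1983, Ch. 14, Cor. 14.1, Lemma 14.3, Cor. 14.27;
S. W. Hawking, G. F. R. Ellis, *The large scale structure of space-time*, CUP 1973, Prop. 6.3.1; M. Visser,
arXiv:0706.0622, (32)–(35); M. Dafermos, I. Rodnianski, arXiv:0811.0354, §5.1.
-/

-- the doubled `FinalStateConjecture.FinalStateConjecture` path component trips dupNamespace (as in the skeleton)
set_option linter.dupNamespace false
set_option maxSynthPendingDepth 3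

noncomputable section

open Set Filter Function Metric
open scoped Topology ContDiff

namespace Summit.FinalStateConjecture.FinalStateConjecture.Theorems.PhaseMixingCaptureCaptureSufficesTame

open Literature.Geometry.Lorentzian

open NoC0Glue in
/-- **Glue stub `stub_noC0_glue`, ORIENTED form (`stub_noC0_glue_oriented`).** DATA: `0 ≤ M`, a control region
`Ω ⊆` Kerr exterior (open), a chunk `Ω'` (open, `closure Ω' ⊆ Ω` compact), `p₀ ∈ Ω'`, and a chart `Φ : E4 → E4`,
smooth and injective on `Ω`, with `‖Φ^*η − g_{M,a}‖ ≤ ε ≤ 1/80` on `Ω` and ORIENTATION PRESERVED: `DΦ_y` maps future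
`Φ^*η`-causal vectors (`(Φ^*η)(v,v) ≤ 0 < v⁰`) to vectors with positive time component (without this hypothesis the
statement fails, e.g. for the time reflection of Minkowski space far out in the exterior). With `J` the flat causal
future of `P = Φ p₀` inside `U = Φ '' Ω'`, `C = Ω' ∩ Φ⁻¹(closure J)`, `O = Ω' ∩ Φ⁻¹(interior J)`: `O ⊆ C ⊆ Ω'`,
`O` open,
`C` relatively closed; (H-D) push-up along `Φ^*η`-timelike paths in `Ω'`; (H-p) `p₀ ∈ C ∖ O`; (H-t) `t* ≥ p₀⁰` on `C`;
(H-reach) `C` is approximated by ends of `t*`-parametrised `Φ^*η`-causal paths from `p₀`; (H-gen) boundary points near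
`p₀` (explicit radius `dist(p₀, Ω'ᶜ)/4`, uniform in `Φ`) lie on `t*`-parametrised `Φ^*η`-null paths from `p₀` inside
`C ∖ O` that approach `Ω'ᶜ`. Mechanism: `DΦ` is
invertible (`ε`-isometry of the uniformly nondegenerate `g_{M,a}`), so `Φ|Ω` is open with a continuous differentiable
inverse; flat causal paths and `Φ^*η`-causal paths correspond (time orientation by hypothesis); bricks F1/F2 (flat
push-up, lit rays, boundary generators) and K3 (`t*` strictly increasing, speed `≤ 2`) are transported through the
chart. O'Neill 1983, Ch. 14, Cor. 14.1 and Cor. 14.27; Hawking–Ellis 1973, Prop. 6.3.1.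
[cite: ONeill1983, Ch. 14, Cor. 14.1] [cite: HawkingEllis1973, Prop. 6.3.1] -/
theorem stub_noC0_glue_oriented :
    ∀ (M a : ℝ) (Ω Ω' : Set E4) (Φ : E4 → E4) (ε : ℝ) (p₀ : E4), 0 ≤ M →
      IsOpen Ω → Ω ⊆ (Kerr.exterior M a : Set E4) → IsOpen Ω' → closure Ω' ⊆ Ω → IsCompact (closure Ω') →
      p₀ ∈ Ω' → ContDiffOn ℝ ∞ Φ Ω → InjOn Φ Ω → 0 ≤ ε → ε ≤ 1 / 80 →
      (∀ y ∈ Ω, ‖MetricCoord.pullMetric (fun _ ↦ Minkowski.bilin) Φ y - Kerr.bilin M a y‖ ≤ ε) →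
      (∀ y ∈ Ω, ∀ v : E4, MetricCoord.pullMetric (fun _ ↦ Minkowski.bilin) Φ y v v ≤ 0 → 0 < v 0 →
        0 < (fderiv ℝ Φ y v) 0) →
      ∀ J : Set E4,
        J = {Y | Y ∈ Φ '' Ω' ∧ (Y = Φ p₀ ∨ ∃ (γ : ℝ → E4) (a b : ℝ), a < b ∧ γ a = Φ p₀ ∧ γ b = Y ∧
              ∀ t ∈ Set.Icc a b, γ t ∈ Φ '' Ω' ∧
                ∃ v : E4, HasDerivAt γ v t ∧ Minkowski.bilin v v ≤ 0 ∧ 0 < v 0)} →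
      ∀ C O : Set E4, C = Ω' ∩ Φ ⁻¹' closure J → O = Ω' ∩ Φ ⁻¹' interior J →
      O ⊆ C ∧ C ⊆ Ω' ∧ IsOpen O ∧ (∀ y ∈ Ω', y ∈ closure C → y ∈ C) ∧
      (∀ y ∈ C, ∀ z ∈ Ω', (∃ (c : ℝ → E4) (s₁ s₂ : ℝ), s₁ < s₂ ∧ c s₁ = y ∧ c s₂ = z ∧
          ∀ t ∈ Icc s₁ s₂, c t ∈ Ω' ∧ ∃ v : E4, HasDerivAt c v t ∧
            MetricCoord.pullMetric (fun _ ↦ Minkowski.bilin) Φ (c t) v v < 0 ∧ 0 < v 0) → z ∈ O) ∧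
      (p₀ ∈ C ∧ p₀ ∉ O) ∧
      (∀ y ∈ C, p₀ 0 ≤ y 0) ∧
      (∀ y ∈ C, ∀ δ > 0, ∃ y' ∈ Ω', ‖y' - y‖ < δ ∧ (y' = p₀ ∨ ∃ c : ℝ → E4, c (p₀ 0) = p₀ ∧
          c (y' 0) = y' ∧ p₀ 0 < y' 0 ∧ ∀ t ∈ Icc (p₀ 0) (y' 0), c t ∈ Ω' ∧ c t 0 = t ∧
            ∃ v : E4, HasDerivAt c v t ∧ MetricCoord.pullMetric (fun _ ↦ Minkowski.bilin) Φ (c t) v v ≤ 0 ∧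
              v 0 = 1)) ∧
      (∀ x ∈ C, x ∉ O → x ≠ p₀ → x 0 < p₀ 0 + infDist p₀ Ω'ᶜ / 4 → ‖x - p₀‖ < infDist p₀ Ω'ᶜ / 4 →
          ∃ (μ : ℝ → E4) (E : ℝ), x 0 < E ∧ μ (p₀ 0) = p₀ ∧ μ (x 0) = x ∧
            (∀ t ∈ Ico (p₀ 0) E, μ t ∈ C ∧ μ t ∉ O ∧ μ t 0 = t ∧
              ∃ v : E4, HasDerivAt μ v t ∧ MetricCoord.pullMetric (fun _ ↦ Minkowski.bilin) Φ (μ t) v v ≤ 0 ∧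
                v 0 = 1) ∧
            (∀ η > 0, ∀ t₀ < E, ∃ t, t₀ ≤ t ∧ p₀ 0 ≤ t ∧ t < E ∧ infDist (μ t) Ω'ᶜ < η)) := by
  intro M a Ω Ω' Φ ε p₀ hM hΩ hΩext hΩ' hclΩ hcpt hp₀ hΦ hinj _hε0 hε hclose hO J hJ C O hC hOd
  have hΩ'Ω : Ω' ⊆ Ω := subset_closure.trans hclΩ
  have hG : ∀ y ∈ Ω, invFunOn Φ Ω (Φ y) = y := fun y hy ↦ hinj.leftInvOn_invFunOn hy
  have hcontΩ' : ContinuousOn Φ Ω' := hΦ.continuousOn.mono hΩ'Ω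
  subst hC hOd
  refine ⟨fun y hy ↦ ⟨hy.1, subset_closure (interior_subset hy.2)⟩, inter_subset_left,
    isOpen_inter_preimage_interior hΩ' hcontΩ',
    fun y hy hycl ↦ mem_of_mem_closure_inter_preimage hcontΩ' hy hycl,
    fun y hy z hz hpath ↦ pushup hM hΩ hΩext hΦ hε hclose hO hΩ' hΩ'Ω hp₀ hJ hy hz hpath,
    base_mem_not_mem hM hΩ hΩext hΦ hε hclose hΩ' hΩ'Ω hp₀ hJ,
    fun y hy ↦ base_time_le hM hΩ hΩext hΦ hε hclose hO hG hΩ'Ω hp₀ hJ hy,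
    fun y hy δ hδ ↦ reach hM hΩ hΩext hΦ hε hclose hO hG hΩ'Ω hp₀ hJ hy hδ,
    gen hM hΩ hΩext hΦ hε hclose hO hG hΩ' hclΩ hcpt hp₀ hJ⟩

end Summit.FinalStateConjecture.FinalStateConjecture.Theorems.PhaseMixingCaptureCaptureSufficesTame

end
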